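import Literature.NumberTheory.GaloisCohomology.Howard2004.TowerCasselsTatePairingSkewSumProofs
import Literature.NumberTheory.GaloisCohomology.Howard2004.ShaOneVanishingOfChebotarevProofs
import Literature.NumberTheory.GaloisCohomology.Howard2004.TowerSelmerGlobalLiftProofs
import Literature.NumberTheory.GaloisCohomology.Howard2004.TowerCasselsTatePairingOfDefectsProofs
import Literature.NumberTheory.GaloisCohomology.Howard2004.TowerCasselsTatePairingBalancedProofs
import Literature.NumberTheory.GaloisCohomology.Howard2004.TowerSelmerLiftPairingRightOrthogonalProofs
import Literature.NumberTheory.GaloisCohomology.Howard2004.TowerDualityReadingCompatProofs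
import Literature.NumberTheory.GaloisCohomology.Howard2004.TowerCompatibleFrobeniusCharactersProofs
import Literature.NumberTheory.GaloisCohomology.Howard2004.DVRSettingDualSelmerTransferProofs
import Literature.NumberTheory.GaloisCohomology.Howard2004.DVRSettingLevelConditionsCartesianProofs
import Literature.NumberTheory.GaloisCohomology.Howard2004.CasselsTateSkewPairingPrintIntendedOfTowerZModPairingsProofs
import Literature.NumberTheory.GaloisCohomology.Howard2004.TowerZModLeftKernelPairingOfLettersProofs
import Literature.NumberTheory.GaloisCohomology.Howard2004.TowerCasselsTatePairingRightOrthogonalProofs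
import Literature.NumberTheory.GaloisCohomology.Howard2004.DualSelmerTransferScalarsProofs
import Literature.NumberTheory.EllipticCurves.PoitouTateSelmerStructuresConj
import HarnessLib

/-!
# Howard 2004, Prop. 1.4.1 / Thm. 1.4.2 (Flach) AS INTENDED — C45.1″ as a KERNEL THEOREM modulo Čebotarev and Poitou–Tate
# (proofs file; the closing brick «C451-CL Q7c» of cell `pub/bsd-print-x9`'s class-level port)

Topic `NumberTheory/GaloisCohomology/Howard2004`. THEOREMS ONLY: no definition, no named fact, no instance, no notation,
no `sorry`.  Seat `bsd-line-x10b-p1` LEAD g14, `--supports stmt-BirchSwinnertonDyer-22642`.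

WHAT IS PROVED.
* §1 **`DVRSetting.exists_towerZModLeftKernelPairing`** — on a FULL `DVRSetting` (`e_i = i + 1`) with H.0–H.5 and
  `p ∤ #𝓞_K^×`, granted Čebotarev (`Automorphic.chebotarev_artinRep`), Poitou–Tate duality of `Ш²`/`Ш¹`
  (`poitouTate_sha_tateDual K`) and Poitou–Tate for Selmer structures with a conjugation-compatible family
  (`poitouTate_selmerStructure_duality_conj K`): for every `(k, n ∈ 𝓝^{(k)}, t + 1 < e_k)` there is a bi-additive `R`-balanced
  `Q : H¹_{𝓕(n)}(K, T^{(t)}) × H¹_{𝓕(n)}(K, T^{(0)}) → ℤ/p` with LEFT kernel `= range H¹(red_{t+1→t})`, killing `range H¹(red_{t+1→0})`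
  on the right, and skew.  ASSEMBLY of the cell's bricks: the level `p^{t+2}` of local duality and its family `inv`
  (`IsPerfect`, reciprocity, `SelmerComplement`, `IsConjCompatible`); a trivialisation of `μ_{p^{t+2}}`; compatible Frobenius
  readings `λ₀, λ_{t+1}` (x10b-p1-w8); the pinned presentation `ι` of `ker red_{t+1→t}` (x10b-p1-w2); `Ш²(K, T̄) = 0`
  (`shaTwo_level_zero_eq_bot`, this seat) hence global lifts (w8); the class-level Cassels–Tate pairing `P` (w2); the dual
  slots `Ψ₀, Ψ_{t+1}` and `e₀ : 𝓗_0(n) ≃ Sel^*_0` with its scalar law (x10b-p1-w7); RIGHT-P (w8); SKEW-P from this seat's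
  `sum_defectPairing_add_sum_defectPairing_eq_zero` with the letters ISO (w7) / ADJ-ι, ADJ-red (w8); then
  `exists_towerZModLeftKernelPairing_of_letters` (socle reading to `ℤ/p`).
* §2 **`prop141_casselsTate_skewPairing_atLevel_printIntended_of_poitouTate`** — the print-as-intended leaf C45.1″ from the
  three inputs (`prop141_casselsTate_skewPairing_atLevel_printIntended_of_forall_full_towerZModLeftKernelPairings`), and
  **`DVRSetting.hasLevelDecompositionsAt_of_poitouTate`** (Thm. 1.4.2 for every `(T^{(k)}, 𝓕(n))` of a full setting).

HONEST FRAMING: the three inputs are hypotheses here — Čebotarev is PROVED in the tree (`chebotarev_artinRep_holds`), the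
two Poitou–Tate statements are proved Summits-side for the canonical family; with them C45.1″ becomes a kernel theorem and
Howard's Thm. 1.6.1-as-intended (F-161′) follows by `thm161_printIntended_of_prop141_printIntended`.  The Birch–Swinnerton-Dyer
conjecture is not proved by any of this; no summit statement is proved in this file.

References: [Howard2004HeegnerKolyvagin] B. Howard, Compositio Math. **140** (2004) = arXiv:1202.6340, Prop. 1.4.1, Thm. 1.4.2 with
proof (p0008 L83 – p0009 L55), Lemma 1.5.1, §1.6 ¶1; [Flach1990] Thm. 1, Thm. 2; [MorganSmith2021CTP] Thm. 1.3, Def. 3.2, Prop. 3.3,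
Prop. 3.5, Thm. 3.7, Rem. 6.3; [MilneADT2006] Ch. I, Cor. 2.3, Thm. 4.10; [CasselsFrohlichANT1967] Ch. VI §1.1, Ch. VII §2.4.
-/

set_option autoImplicit false

noncomputable section

namespace Literature.NumberTheory.GaloisCohomology.Howard2004

open Function NumberField IsDedekindDomain Field CategoryTheory
open scoped NumberField ContRepresentation
open Literature.NumberTheory.GaloisRepresentations
open Literature.NumberTheory.GaloisRepresentations.DiscreteGaloisModule
open Literature.NumberTheory.GaloisCohomology (LocalInvariants)
open Literature.NumberTheory.EllipticCurves

namespace DVRSetting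

variable {p : ℕ} [Fact p.Prime] {K : Type} [Field K] [NumberField K]
  {R : Type} [CommRing R] [IsDomain R] [IsDiscreteValuationRing R] [Algebra ℤ_[p] R]
  {N : ℕ → Type} [∀ k, AddCommGroup (N k)] [∀ k, TopologicalSpace (N k)]
  [∀ k, DiscreteTopology (N k)] [∀ k, Module R (N k)]
  {Rk : ℕ → Type} [∀ k, CommRing (Rk k)] [∀ k, IsLocalRing (Rk k)] [∀ k, TopologicalSpace (Rk k)]
  [∀ k, DiscreteTopology (Rk k)] [∀ k, Algebra ℤ_[p] (Rk k)] [∀ k, Algebra R (Rk k)]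
  [∀ k, Module (Rk k) (N k)] [∀ k, IsScalarTower R (Rk k) (N k)]
  {Nbar : Type} [AddCommGroup Nbar] [TopologicalSpace Nbar] [DiscreteTopology Nbar]
  [∀ k, Module (Rk k) Nbar]
  {Nq : ℕ → Finset (HeightOneSpectrum (𝓞 K)) → Type} [∀ k n, AddCommGroup (Nq k n)]
  [∀ k n, TopologicalSpace (Nq k n)] [∀ k n, DiscreteTopology (Nq k n)]
  [∀ k n, Module (Rk k) (Nq k n)] [∀ k n, Module R (Nq k n)]
  [∀ k n, IsScalarTower R (Rk k) (Nq k n)]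

/-! ## §1 The left-kernel tower pairing of a full setting -/

set_option maxHeartbeats 400000 in
/-- **THE `ℤ/p`-VALUED LEFT-KERNEL TOWER PAIRING OF A FULL SETTING** (Howard Prop. 1.4.1 / Thm. 1.4.2 (i)(ii) on classes; see
the module docstring for the assembly).
[cite: Howard2004HeegnerKolyvagin, Prop. 1.4.1 and Thm. 1.4.2 with proof (arXiv:1202.6340 p0008 L83 – p0009 L55), Lemma 1.5.1, §1.6 ¶1]
[cite: Flach1990, Thm. 1 and Thm. 2] [cite: MorganSmith2021CTP, Thm. 1.3, Prop. 3.5, Thm. 3.7 and Rem. 6.3] [cite: MilneADT2006, Ch. I, Cor. 2.3 and Thm. 4.10] -/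
theorem exists_towerZModLeftKernelPairing (S : DVRSetting p K R N Rk Nbar Nq) (hy : S.SatisfiesH)
    (hfull : ∀ i, S.e i = i + 1) (hu : ¬ p ∣ Nat.card (𝓞 K)ˣ)
    (hC : Automorphic.chebotarev_artinRep) (hST : poitouTate_sha_tateDual K)
    (hPTS : poitouTate_selmerStructure_duality_conj K)
    (k : ℕ) (n : Finset (HeightOneSpectrum (𝓞 K))) (hn : ↑n ⊆ S.levelPrimes k) (t : ℕ) (ht : t + 1 < S.e k) :
    ∃ Q : ↥(S.selmerModuleAt hy t n) →+ ↥(S.selmerModuleAt hy 0 n) →+ ZMod p,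
      (letI := galoisCohomology.moduleH1 (S.T.ρ t) (S.T.hlin t);
        letI := galoisCohomology.moduleH1 (S.T.ρ 0) (S.T.hlin 0);
        ∀ (r : R) (a : ↥(S.selmerModuleAt hy t n)) (w : ↥(S.selmerModuleAt hy 0 n)), Q (r • a) w = Q a (r • w)) ∧
      (letI := galoisCohomology.moduleH1 (S.T.ρ t) (S.T.hlin t);
        letI := galoisCohomology.moduleH1 (S.T.ρ (t + 1)) (S.T.hlin (t + 1));
        ∀ a : ↥(S.selmerModuleAt hy t n), (∀ w, Q a w = 0) ↔
          a ∈ LinearMap.range (S.redSelLE hy (Nat.le_succ t) n)) ∧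
      (letI := galoisCohomology.moduleH1 (S.T.ρ 0) (S.T.hlin 0);
        letI := galoisCohomology.moduleH1 (S.T.ρ (t + 1)) (S.T.hlin (t + 1));
        ∀ (z : ↥(S.selmerModuleAt hy (t + 1) n)) (a : ↥(S.selmerModuleAt hy t n)),
          Q a (S.redSelLE hy (Nat.zero_le (t + 1)) n z) = 0) ∧
      (letI := galoisCohomology.moduleH1 (S.T.ρ t) (S.T.hlin t);
        letI := galoisCohomology.moduleH1 (S.T.ρ 0) (S.T.hlin 0);
        ∀ a b : ↥(S.selmerModuleAt hy t n),
          Q a (S.redSelLE hy (Nat.zero_le t) n b) = - Q b (S.redSelLE hy (Nat.zero_le t) n a)) := by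
  classical
  letI modt : Module R (galoisCohomology (S.T.ρ t) 1) := galoisCohomology.moduleH1 (S.T.ρ t) (S.T.hlin t)
  letI mod0 : Module R (galoisCohomology (S.T.ρ 0) 1) := galoisCohomology.moduleH1 (S.T.ρ 0) (S.T.hlin 0)
  letI mods : Module R (galoisCohomology (S.T.ρ (t + 1)) 1) :=
    galoisCohomology.moduleH1 (S.T.ρ (t + 1)) (S.T.hlin (t + 1))
  haveI hfin : ∀ j, Finite (N j) := fun j ↦ S.finite_level hy j
  have hp : p.Prime := Fact.out
  have he0 : S.e 0 = 1 := by rw [hfull]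
  have het : S.e (t + 1) = t + 1 + 1 := hfull (t + 1)
  have htk : t + 1 ≤ k := by rw [hfull k] at ht; omega
  have hn1 : ↑n ⊆ S.levelPrimes (t + 1) := hn.trans (S.levelPrimes_antitone hy htk)
  have hn0 : ↑n ⊆ S.levelPrimes 0 := hn1.trans (S.levelPrimes_antitone hy (Nat.zero_le _))
  -- the level `p^{t+2}` of local duality
  have hk'1 : ((p : ℕ) : R) ^ (t + 1 + 1) ∈ IsLocalRing.maximalIdeal R ^ S.e (t + 1) := by
    rw [← het]; exact S.natCast_pow_mem_maximalIdeal_pow_of_le hy le_rfl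
  have hk'0 : ((p : ℕ) : R) ^ (t + 1 + 1) ∈ IsLocalRing.maximalIdeal R ^ S.e 0 :=
    Ideal.pow_le_pow_right (hy.e_strictMono.monotone (Nat.zero_le (t + 1))) hk'1
  haveI : NeZero (p ^ (t + 1 + 1)) := ⟨pow_ne_zero _ hp.ne_zero⟩
  have hM1 : ∀ x : N (t + 1), p ^ (t + 1 + 1) • x = 0 := S.pow_natCast_smul_eq_zero_level hy (t + 1) hk'1
  have hM0 : ∀ x : N 0, p ^ (t + 1 + 1) • x = 0 := S.pow_natCast_smul_eq_zero_level hy 0 hk'0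
  -- the family of local invariant maps
  obtain ⟨inv, hperf, hPT, -, hSC, hconj⟩ := hPTS (p ^ (t + 1 + 1))
  have hinv : inv.IsConjCompatible S.cd.σ := hconj S.cd.σ
  -- a bijective equivariant trivialisation of `μ_{p^{t+2}}`
  have hpK : (p : K) ≠ 0 := Nat.cast_ne_zero.mpr hp.ne_zero
  obtain ⟨log, hlogbij, hlogχ, -⟩ := exists_compatible_muLog K p hpK
  let Lg : MuCarrier K (p ^ (t + 1 + 1)) ≃+ ZMod (p ^ (t + 1 + 1)) :=
    AddEquiv.ofBijective (log (t + 1 + 1)) (hlogbij (t + 1 + 1))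
  let exp : ZMod (p ^ (t + 1 + 1)) →+ MuCarrier K (p ^ (t + 1 + 1)) := Lg.symm
  have hexpb : Bijective exp := Lg.symm.bijective
  have hexp : ∀ (g : absoluteGaloisGroup K) (x : ZMod (p ^ (t + 1 + 1))),
      exp (cyclotomicCharacterModPow K p (t + 1 + 1) g * x) = mu K (p ^ (t + 1 + 1)) g (exp x) := fun g x ↦ by
    apply Lg.injective
    change Lg (Lg.symm _) = log (t + 1 + 1) (mu K _ g (Lg.symm x))
    rw [AddEquiv.apply_symm_apply, hlogχ, show log (t + 1 + 1) (Lg.symm x) = Lg (Lg.symm x) from rfl,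
      AddEquiv.apply_symm_apply]
  -- compatible Frobenius readings
  obtain ⟨lam₀, lam₁, hlam₀, hlam₁, hfrob₀, hfrob₁, hcompat⟩ :=
    S.exists_compatible_frobeniusCharacters_semilinear hy t hk'1
  -- the presentation `ι : T^{(0)} → T^{(t+1)}` of `ker red_{t+1→t}`
  have hπm : S.π ∈ IsLocalRing.maximalIdeal R := by rw [hy.unif]; exact Ideal.mem_span_singleton_self _
  have hle : ∀ j, S.e j ≤ S.e (j + 1) := fun j ↦ hy.e_strictMono.monotone (Nat.le_succ j)
  obtain ⟨ι, hιg, hι⟩ := S.exists_linearMap_comp_redLE_eq hy hπm hle (Nat.zero_le (t + 1))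
  have hιinj : Function.Injective ι := S.injective_of_comp_redLE_eq hy _ ι hι
  have heq : S.e 0 + S.e t = S.e (t + 1) := by rw [hfull 0, hfull t, hfull (t + 1)]; omega
  have hιex : ∀ y : N (t + 1), S.T.redLE (Nat.le_succ t) y = 0 ↔ ∃ x, ι x = y := fun y ↦
    S.redLE_eq_zero_iff_mem_range_of_comp_redLE_eq hy (Nat.zero_le (t + 1)) (Nat.le_succ t) heq ι hι y
  have hιF := fun v m ↦ S.cohomologyMap_mem_atLevel_cond_iff_of_comp_redLE_eq hy (Nat.zero_le (t + 1)) hn1 ι hιg hι v m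
  have hι0 : ∀ s : N 0, S.T.redLE (Nat.zero_le (t + 1)) (ι s) = 0 :=
    S.redLE_iota_eq_zero hy ι hι (by rw [hfull 0, hfull (t + 1)]; omega)
  -- global lifts (`Ш²(K, T̄) = 0`)
  have hsha2 : shaTwo (S.T.ρ 0) = ⊥ := S.shaTwo_level_zero_eq_bot hy hC hST he0
  have hlift : ∀ a ∈ (((S.t t).atLevel S.jbar n).cond).selmerGroup,
      ∃ ã : galoisCohomology (S.T.ρ (t + 1)) 1, S.redLEH1 (Nat.le_succ t) ã = a := fun a ha ↦
    S.exists_redLEH1_eq_of_mem_selmerGroup_atLevel_of_shaTwo hy hu hfull hsha2 t hn1 ha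
  -- the class-level pairing
  obtain ⟨P, hP⟩ := S.exists_towerCasselsTatePairing hy hu (Nat.le_succ t) hn1 ι hιg hιinj hιex hιF hM0 inv hPT hlift
  have hn0S : ∀ v : HeightOneSpectrum (𝓞 K), (Sum.inr v : Place K) ∉ S.Sigma →
      ((p ^ (t + 1 + 1) : ℕ) : 𝓞 K) ∉ v.asIdeal ∧ GaloisRep.IsUnramifiedAt v (S.T.ρ 0) := fun v hv ↦
    S.not_mem_and_isUnramifiedAt_of_not_mem_Sigma 0 (t + 1 + 1) v (by rwa [hy.Sigma_eq 0])
  -- the dual slots at the levels `0` and `t+1`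
  obtain ⟨Ψ₀, hΨ₀⟩ := exists_conjTransfer S.cd (S.T.ρ 0) ((S.T.ρ 0).tateDual (p ^ (t + 1 + 1)))
    ((S.D 0).toTateDual lam₀ hlam₀ exp hexp).toContinuousLinearMap.toLinearMap.toAddMonoidHom
    ((S.D 0).toTateDual_semilinear lam₀ hlam₀ exp hexp)
  obtain ⟨e₀, he₀, he₀s⟩ := S.exists_addEquiv_selmerModuleAt_dualSelmerGroup hy hu 0 hk'0 exp hexp hexpb lam₀ hlam₀ hfrob₀
    inv hperf hn0 Ψ₀ hΨ₀
  obtain ⟨Ψ₁, hΨ₁⟩ := exists_conjTransfer S.cd (S.T.ρ (t + 1)) ((S.T.ρ (t + 1)).tateDual (p ^ (t + 1 + 1)))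
    ((S.D (t + 1)).toTateDual lam₁ hlam₁ exp hexp).toContinuousLinearMap.toLinearMap.toAddMonoidHom
    ((S.D (t + 1)).toTateDual_semilinear lam₁ hlam₁ exp hexp)
  obtain ⟨e₁, he₁⟩ := S.exists_addEquiv_selmerGroup_atLevel_dualSelmerGroup hy hu (t + 1) hk'1 exp hexp hexpb lam₁ hlam₁
    hfrob₁ inv hperf hn1 Ψ₁ hΨ₁
  -- localisations of the dual slots (bridge spelling)
  have hlocΨ₀ : ∀ (w : HeightOneSpectrum (𝓞 K)) (c : galoisCohomology (S.T.ρ 0) 1),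
      galoisCohomology.localization ((S.T.ρ 0).tateDual (p ^ (t + 1 + 1))) (Sum.inr w) 1 (Ψ₀ c) =
        galoisCohomology.map (DiscreteGaloisModule.localMap ((S.D 0).toTateDual lam₀ hlam₀ exp hexp) (Sum.inr w)) 1
          (S.cd.transportH1 (S.T.ρ 0) w (galoisCohomology.localization (S.T.ρ 0) (Sum.inr (S.cd.σ • w)) 1 c)) := by
    intro w c
    rw [conjTransfer_localization S.cd (S.T.ρ 0) _ _ ((S.D 0).toTateDual_semilinear lam₀ hlam₀ exp hexp) Ψ₀ hΨ₀ w c,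
      DualityDatum.map_localMap_toTateDual_eq_cohomologyMap]
  have hlocΨ₁ : ∀ (w : HeightOneSpectrum (𝓞 K)) (c : galoisCohomology (S.T.ρ (t + 1)) 1),
      galoisCohomology.localization ((S.T.ρ (t + 1)).tateDual (p ^ (t + 1 + 1))) (Sum.inr w) 1 (Ψ₁ c) =
        galoisCohomology.map (DiscreteGaloisModule.localMap ((S.D (t + 1)).toTateDual lam₁ hlam₁ exp hexp) (Sum.inr w)) 1
          (S.cd.transportH1 (S.T.ρ (t + 1)) w
            (galoisCohomology.localization (S.T.ρ (t + 1)) (Sum.inr (S.cd.σ • w)) 1 c)) := by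
    intro w c
    rw [conjTransfer_localization S.cd (S.T.ρ (t + 1)) _ _ ((S.D (t + 1)).toTateDual_semilinear lam₁ hlam₁ exp hexp) Ψ₁ hΨ₁
      w c, DualityDatum.map_localMap_toTateDual_eq_cohomologyMap]
  -- ISO at the level `t+1` (H.4 for `𝓕(n)`, x10b-p1-w7)
  have hISO : ∀ (w : HeightOneSpectrum (𝓞 K)) (ℓ : galoisCohomology ((S.T.ρ (t + 1)).toLocal (Sum.inr w)) 1)
      (_ : ℓ ∈ ((S.t (t + 1)).atLevel S.jbar n).cond (Sum.inr w))
      (ℓ' : galoisCohomology ((S.T.ρ (t + 1)).toLocal (Sum.inr (S.cd.σ • w))) 1)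
      (_ : ℓ' ∈ ((S.t (t + 1)).atLevel S.jbar n).cond (Sum.inr (S.cd.σ • w))),
      localTatePairingZMod (S.T.ρ (t + 1)) (p ^ (t + 1 + 1)) (Sum.inr w) (inv (Sum.inr w)) ℓ
        (galoisCohomology.map (DiscreteGaloisModule.localMap ((S.D (t + 1)).toTateDual lam₁ hlam₁ exp hexp)
          (Sum.inr w)) 1 (S.cd.transportH1 (S.T.ρ (t + 1)) w ℓ')) = 0 := by
    intro w ℓ hℓ ℓ' hℓ'
    have hle := S.map_toTateDual_transportH1_atLevel_le_dualLocalCondition hy hu (t + 1) hk'1 exp hexp hexpb lam₁ hlam₁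
      inv hperf hn1 w
    have hmem := hle ⟨ℓ', hℓ', rfl⟩
    rw [DualityDatum.map_localMap_toTateDual_eq_cohomologyMap]
    exact (LocalInvariants.mem_dualLocalCondition_iff _ _ _ _ _).1 hmem ℓ hℓ
  refine S.exists_towerZModLeftKernelPairing_of_letters hy hu he0 hn1 ι hιg hιinj hιex hιF inv hSC hPT hn0S hlift P hP
    e₀ he₀s ?_ ?_
  · -- RIGHT-P (x10b-p1-w8)
    intro a z
    refine S.towerCasselsTatePairing_eq_zero_of_eq_dualSlot_redLEH1 hy hu (Nat.le_succ t) hn1 ι hιg hιinj hιex hι hM1 inv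
      hPT hlift P hP lam₀ lam₁ hlam₀ hlam₁ exp hexp hcompat Ψ₀ hΨ₀ Ψ₁ hΨ₁ a _ z.1 ?_ ?_
    · rw [← he₁ ⟨z.1, z.2⟩]
      exact (e₁ ⟨z.1, z.2⟩).2
    · rw [he₀]
      rfl
  · -- SKEW-P (this seat's `sum_defectPairing_add_sum_defectPairing_eq_zero`)
    intro a b
    have hσσ : ∀ v : HeightOneSpectrum (𝓞 K), S.cd.σ • (S.cd.σ • v) = v := fun v ↦ by
      rw [smul_smul, S.cd.sigma_mul_sigma_eq_one, one_smul]
    -- lifts and defects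
    obtain ⟨aL, haL⟩ := hlift a.1 a.2
    obtain ⟨bL, hbL⟩ := hlift b.1 b.2
    obtain ⟨Sfa, ma, hma, hmaS⟩ := S.exists_localDefects_of_redLEH1_mem hy hu (Nat.le_succ t) hn1 ι hιg hιinj hιex aL
      (haL ▸ a.2)
    obtain ⟨Sfb, mb, hmb, hmbS⟩ := S.exists_localDefects_of_redLEH1_mem hy hu (Nat.le_succ t) hn1 ι hιg hιinj hιex bL
      (hbL ▸ b.2)
    -- a `σ`-stable finite set of finite places supporting both defect families
    let T₀ : Finset (HeightOneSpectrum (𝓞 K)) := (Sfa ∪ Sfb).preimage Sum.inr (Sum.inr_injective.injOn)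
    let S₀ : Finset (HeightOneSpectrum (𝓞 K)) := T₀ ∪ T₀.image (fun v ↦ S.cd.σ • v)
    have hS₀ : ∀ v ∈ S₀, S.cd.σ • v ∈ S₀ := by
      intro v hv
      rcases Finset.mem_union.1 hv with h | h
      · exact Finset.mem_union_right _ (Finset.mem_image.2 ⟨v, h, rfl⟩)
      · obtain ⟨u, hu', rfl⟩ := Finset.mem_image.1 h
        rw [hσσ]
        exact Finset.mem_union_left _ hu'
    have hT₀ : ∀ w : HeightOneSpectrum (𝓞 K), w ∉ S₀ → (Sum.inr w : Place K) ∉ Sfa ∪ Sfb := fun w hw h ↦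
      hw (Finset.mem_union_left _ (Finset.mem_preimage.2 h))
    have hmaS' : ∀ w : HeightOneSpectrum (𝓞 K), w ∉ S₀ → ma (Sum.inr w) = 0 := fun w hw ↦
      hmaS _ fun h ↦ hT₀ w hw (Finset.mem_union_left _ h)
    have hmbS' : ∀ w : HeightOneSpectrum (𝓞 K), w ∉ S₀ → mb (Sum.inr w) = 0 := fun w hw ↦
      hmbS _ fun h ↦ hT₀ w hw (Finset.mem_union_right _ h)
    -- both families vanish off `S₀.map inr` (infinite places: `H¹ = 0`)
    have hoff : ∀ (m : ∀ v : Place K, galoisCohomology ((S.T.ρ 0).toLocal v) 1),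
        (∀ w : HeightOneSpectrum (𝓞 K), w ∉ S₀ → m (Sum.inr w) = 0) →
        ∀ v ∉ S₀.map ⟨Sum.inr, Sum.inr_injective⟩, m v = 0 := by
      intro m hm v hv
      rcases v with w | w
      · haveI := S.subsingleton_galoisCohomology_toLocal_inl_level hy 0 w le_rfl
        exact Subsingleton.elim _ _
      · exact hm w fun h ↦ hv (Finset.mem_map.2 ⟨w, h, rfl⟩)
    -- the values of `P` on `S₀`
    have hPa := hP ⟨a.1, a.2⟩ aL haL ma hma (S₀.map ⟨Sum.inr, Sum.inr_injective⟩) (hoff ma hmaS')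
      (e₀ (S.redSelLE hy (Nat.zero_le t) n b))
    have hPb := hP ⟨b.1, b.2⟩ bL hbL mb hmb (S₀.map ⟨Sum.inr, Sum.inr_injective⟩) (hoff mb hmbS')
      (e₀ (S.redSelLE hy (Nat.zero_le t) n a))
    rw [Finset.sum_map] at hPa hPb
    rw [hPa, hPb]
    -- the dual-slot classes through their localisations
    have hWa : ∀ w : HeightOneSpectrum (𝓞 K),
        galoisCohomology.localization ((S.T.ρ 0).tateDual (p ^ (t + 1 + 1))) (Sum.inr w) 1
            ((e₀ (S.redSelLE hy (Nat.zero_le t) n a) :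
              ↥(inv.dualSelmerStructure (S.T.ρ 0) ((S.t 0).atLevel S.jbar n).cond).selmerGroup) :
              galoisCohomology ((S.T.ρ 0).tateDual (p ^ (t + 1 + 1))) 1) =
          galoisCohomology.map (DiscreteGaloisModule.localMap ((S.D 0).toTateDual lam₀ hlam₀ exp hexp) (Sum.inr w)) 1
            (S.cd.transportH1 (S.T.ρ 0) w
              (galoisCohomology.localization (S.T.ρ 0) (Sum.inr (S.cd.σ • w)) 1 (S.redLEH1 (Nat.zero_le t) a.1))) :=
      fun w ↦ by rw [he₀, ← hlocΨ₀]; rfl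
    have hWb : ∀ w : HeightOneSpectrum (𝓞 K),
        galoisCohomology.localization ((S.T.ρ 0).tateDual (p ^ (t + 1 + 1))) (Sum.inr w) 1
            ((e₀ (S.redSelLE hy (Nat.zero_le t) n b) :
              ↥(inv.dualSelmerStructure (S.T.ρ 0) ((S.t 0).atLevel S.jbar n).cond).selmerGroup) :
              galoisCohomology ((S.T.ρ 0).tateDual (p ^ (t + 1 + 1))) 1) =
          galoisCohomology.map (DiscreteGaloisModule.localMap ((S.D 0).toTateDual lam₀ hlam₀ exp hexp) (Sum.inr w)) 1
            (S.cd.transportH1 (S.T.ρ 0) w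
              (galoisCohomology.localization (S.T.ρ 0) (Sum.inr (S.cd.σ • w)) 1 (S.redLEH1 (Nat.zero_le t) b.1))) :=
      fun w ↦ by rw [he₀, ← hlocΨ₀]; rfl
    exact S.sum_defectPairing_add_sum_defectPairing_eq_zero hy lam₀ hlam₀ lam₁ hlam₁ exp hexp he0 n ι hιg hι0 hM1 inv hinv
      hPT hISO
      (fun w m z ↦ S.localTatePairingZMod_cohomologyMap_iota_thetaTransport hy ι hι lam₀ lam₁ hlam₀ hlam₁ exp hexp hcompat
        hιg inv w m z)
      (fun w X m' ↦ S.localTatePairingZMod_thetaTransport_iota hy ι hι lam₀ lam₁ hlam₀ hlam₁ exp hexp hcompat hιg inv w X m')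
      a.1 b.1 aL bL haL hbL ma mb hma hmb S₀ hS₀ hmaS' hmbS' _ _ hWa hWb (Ψ₁ bL) (fun w ↦ hlocΨ₁ w bL)

/-! ## §2 The print-as-intended leaf C45.1″ and Thm. 1.4.2 on full settings -/

/-- **Howard Thm. 1.4.2 for every `(T^{(k)}, 𝓕(n))` of a FULL setting** with H.0–H.5 and `p ∤ #𝓞_K^×`, granted Čebotarev and
the two Poitou–Tate statements: `S.HasLevelDecompositionsAt hy` (§1 ∘ `hasLevelDecompositionsAt_of_towerZModLeftKernelPairings`).
[cite: Howard2004HeegnerKolyvagin, Thm. 1.4.2 and §1.6 ¶1 (arXiv:1202.6340 p0008 L83 – p0009 L55, p0011 L33–44)] [cite: Flach1990, Thm. 1 and Thm. 2] -/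
theorem hasLevelDecompositionsAt_of_poitouTate (S : DVRSetting p K R N Rk Nbar Nq) (hy : S.SatisfiesH)
    (hfull : ∀ i, S.e i = i + 1) (hu : ¬ p ∣ Nat.card (𝓞 K)ˣ)
    (hC : Automorphic.chebotarev_artinRep) (hST : poitouTate_sha_tateDual K)
    (hPTS : poitouTate_selmerStructure_duality_conj K) : S.HasLevelDecompositionsAt hy :=
  S.hasLevelDecompositionsAt_of_towerZModLeftKernelPairings hy hfull fun k n hn t ht ↦
    S.exists_towerZModLeftKernelPairing hy hfull hu hC hST hPTS k n hn t ht

end DVRSetting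

/-- **HOWARD PROP. 1.4.1 / THM. 1.4.2 (FLACH) AS INTENDED — C45.1″ `prop141_casselsTate_skewPairing_atLevel_printIntended` —
from Čebotarev and Poitou–Tate alone** (every `DVRSetting` with H.0–H.5, `(p : R) ≠ 0`, `p ∤ #𝓞_K^×`: refine to a full setting
and apply §1; `prop141_casselsTate_skewPairing_atLevel_printIntended_of_forall_full_towerZModLeftKernelPairings`).
[cite: Howard2004HeegnerKolyvagin, Prop. 1.4.1, Thm. 1.4.2, Lemma 1.5.1, §1.6 ¶1 (arXiv:1202.6340 p0008 L83 – p0009 L55, p0009 L127–133, p0011 L33–44)]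
[cite: Flach1990, Thm. 1 and Thm. 2] [cite: MorganSmith2021CTP, Thm. 1.3, Prop. 3.5, Thm. 3.7, Rem. 6.3] [cite: MilneADT2006, Ch. I, Thm. 4.10] -/
theorem prop141_casselsTate_skewPairing_atLevel_printIntended_of_poitouTate (hC : Automorphic.chebotarev_artinRep)
    (hST : ∀ (K : Type) [Field K] [NumberField K], poitouTate_sha_tateDual K)
    (hPTS : ∀ (K : Type) [Field K] [NumberField K], poitouTate_selmerStructure_duality_conj K) :
    prop141_casselsTate_skewPairing_atLevel_printIntended :=
  prop141_casselsTate_skewPairing_atLevel_printIntended_of_forall_full_towerZModLeftKernelPairings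
    fun _ _ K _ _ _ _ _ _ _ _ _ _ _ _ _ _ _ _ _ _ _ _ _ _ _ _ _ _ _ _ _ _ _ _ _ S hy hfull _ hu k n hn t ht ↦
      S.exists_towerZModLeftKernelPairing hy hfull hu hC (hST K) (hPTS K) k n hn t ht

end Literature.NumberTheory.GaloisCohomology.Howard2004

end
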